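import Literature.MathematicalPhysics.QuantumFieldTheory.Balaban1983to89.B1Eq324BenfattoClassSectEMemberPrecisionDoorRecordV4PAdjCurrent
import Literature.MathematicalPhysics.QuantumFieldTheory.Balaban1983to89.B9Eq3136HstarJAtPinsLetterFamily
import Literature.MathematicalPhysics.QuantumFieldTheory.Balaban1983to89.B9Eq336RegularAtAllBondsP

/-!
# `Balaban1983to89.B1Eq324BenfattoClassSectEMemberPrecisionDoorRecordV4PAdjCurrentSchemas` — THE STAR DOORS OF RECORD AT THE v4P LETTERS WITH THE 𝒥-ROW INPUT
# (b†) «η^{d+1}·|(H₁(U)\*J(U))(z)| ≤ j₁» SUPPLIED BY NAME from node N06's (H\*J) road ([B9] p. 422, the sentence between (3.136) and (3.137)) — what the door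
# displays instead is the N06-SPECIES weighted transpose schema of PRINT's `H₁(U)` fed `G′_phys`; the cube-covering letter is DISCHARGED at print's class
# (seat dag-n08-d g42, INTENT-104; node N08 [Balaban1985UV3], row `h324c`)

statement-level companion of published sources with citation tags; every declaration here is a theorem; nothing here is a claim about the
Yang–Mills mass gap

T. Bałaban, *Propagators for lattice gauge theories in a background field*, Commun. Math. Phys. **99** (1985) 389–434 [Balaban1985BackgroundPropagators] (= [B9]):
p. 422 (*«From the regularity condition (3.36) and the inequality (3.133) we have the estimate |(H\*J)(b)| ≦ O(1)Mα₀(Lʲη)⁻³ for b ∈ Λ_j»*), (3.129) p. 421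
(`H₁ = G₁Q*(QG₁Q*)⁻¹`), (3.132)–(3.136) p. 422, (3.35)–(3.36) p. 396, (3.155)–(3.158) pp. 427–428; [Balaban1984PropagatorsII] (= [4]) (2.51) p. 232, Lemma 2.1
(2.60)–(2.61) pp. 233–234, (2.3) p. 224, Lemma 2.4 p. 245, (2.149) p. 249; [Balaban1985Averaging] (= [5]) (125)–(126) p. 36, (136) p. 39; [Balaban1985UV3] (24) p. 262;
[Balaban1982Higgs1] (3.24) p. 616; [BenfattoEtAl1978] Lemma (4.5)–(4.7) p. 152.

WHY THIS MODULE (cell `pub-ymgap`, seat `dag-n08-d` gen 42, INTENT-104).  The doors of `…PrecisionDoorRecordV4PAdjCurrent` §2–§3 (p709207) display, per background, the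
𝒥-ROW INPUT (b†) `∀ z, S z → etaDY x * ‖trAdjY (trDualMatY N) (H1Y … (GpPhysY …) (𝔯 x).Δ2 U) (JY … U) z‖ ≤ j₁` — node N06's (3.136) content for PRINT's `H₁(U)`,
listed by this seat (gen 41) as «unowned between N06 and N08».  It is NOT unowned: seat n06-w8's (H\*J) road (Literature `B9Eq3136HstarJBound`, generic in the
letter; at-pins wrapper now Literature-side and generic in the letter family, `B9Eq3136HstarJAtPinsLetterFamily`, this seat's INTENT-103) proves it from the
N06-SPECIES weighted transpose schema of the model `HcoK … (H1Y … (GpPhysY …) (𝔯 x).Δ2) U` + r06's regularity datum at every fine bond — and at PRINT's class `bg9YP`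
the latter is n06-w8's THEOREM `B9Eq336RegularAtAllBondsP.regularAt_pinScale_of_regYP336` (constant `c_J := 10·L⁷`).  THIS FILE re-issues the FAMILY and SOCKET
doors (plain and `_ofC2`) with (b†) AND the output-support row (c-out) ELIMINATED (the 𝒥-row input now holds at EVERY coarse bond, so the support predicate is
`S := ⊤`): what the door displays in their place is EXACTLY what n06-w8's `…N06HstarJAtPinsWPhysR.hHJ_of_transpose_schemas_wR` displays for `H` — the pins
`bI ∕ hbI0 ∕ hβ1`, the weighted transpose schema `hH1T` (a counting-transpose `𝔗 x U` of `HcoK … (H1Y …) U` with the [4]-(2.51) majorant `B_T·W_T(c)·e^{−δ_T d}`), the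
weight law `η^{d+1}·(W_T(c)·((Lʲη)_c³)⁻¹) ≤ w₁` (for `W_T ≡ 1` or the block count it is `B9Eq3136HstarJAtPinsLetterFamily` §1 with `w₁ = 1`, `3 ≤ d+1`), N06's primitive
constants `q : PinPrims`, the rate budget `α_F(1−2α)δ₀ + ρ_R ≤ δ_T`, `10L⁷·a_T ≤ 1` and ONE constant `t_{HJ}`; the door's `j₁` is `t_{HJ}·a_T·w₁`, its thresholds
`max M₄ (max M_H M_T)` and `min a₀ a_T`.
* §1 ★★★ `eq324_CsDeltaCPstY_lettersYOfRecordV4P_sectEStYOfRecordV7_trBasis_of_stmt3132Printed_P_of_H1Schemas_of_pivotLines_onΛst_on_unit` (family form at print's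
  class, `c35 ≤ 10`) and ★★★★ `…_of_b9LeafX_of_H1Schemas_of_pivotLines_onΛst_on_unit` (modulo node N06's socket of record `h06 : B9LeafX (Y9OfRecordP … (opsYNuStOfRecordV4PE …))`,
  `c35 := c35Y = 10`): p709207 §2's doors with (b†)∕(c-out) replaced as above; still displayed per background: the pivot-line smallness of `V` at bad-source star corners
  (NODE 00's dictionary deviation), [5]'s reality `IsSymmTr ((𝔯 x).Δ2 U)` ∕ `IsSymmTr ((𝔢₀ x).D2J U)`, the PIN of `(𝔢₀ x).D2J` to [5]'s form at print's `H₁`, (c) locality ∕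
  size of `D̃⁽²⁾`, the Δ_k-row `γ₀` (G-B9-09).
* §2 ★★★ ∕ ★★★★ the `_ofC2` twins over `𝔯 := resYOfC2 𝔠` (reality READ FROM [5]'s letter properties), p709207 §3's doors likewise.
HONEST SCOPE.  Count-neutral compositions BY NAME (p709207's doors at `S := ⊤`, `j₁ := t_{HJ}·a_T·w₁`, over `B9Eq3136HstarJAtPinsLetterFamily` §4 and n06-w8's F12); no estimate of
[B9] ∕ [4] ∕ [5] is asserted: (3.133) for `H₁` stays DISPLAYED as the weighted transpose schema `hH1T` (node N06's species; its inhabitant road is n06-w8's F9∕F10 pattern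
«`𝔗 := (C₁ ∘ Q) ∘ G₁` from Thm 3.12's `G₁` sup letter and the weighted (3.132) letter for `(QG₁Q\*)⁻¹`», not typed here), [5]'s letter rows, the pin, the pivot-line row
and the Δ_k-row `γ₀` stay displayed; the IDENT for row `h324c` is NOT made; node N06 ∕ N08 NOT discharged; one finite 𝕋^{d+1} programme — nothing about d = 4
specifically, the continuum, OS axioms, a mass gap or the Clay problem.  No `sorry`, no `def`, no `instance`, no `notation`.
-/

noncomputable section

open MeasureTheory Finset Matrix
open scoped Matrix.Norms.L2Operator

namespace Literature.MathematicalPhysics.QuantumFieldTheory.Balaban1983to89.B1Eq324BenfattoClassSectEMemberPrecisionDoorRecordV4PAdjCurrentSchemas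

open Literature.MathematicalPhysics.QuantumFieldTheory
open Literature.MathematicalPhysics.QuantumFieldTheory.Balaban1983to89.B1Eq324BenfattoLemma
open Literature.MathematicalPhysics.QuantumFieldTheory.Balaban1983to89.Node00
open Literature.MathematicalPhysics.QuantumFieldTheory.Balaban1983to89.DagBinding (B9LeafX)
open B6KLevelCensusIndexV1 (KIdx)
open B6BondElimination (unitVec)
open B9PinMembersKLevelV1 (MemberY geo9Y bg9Y)
open B9BackgroundsKLevelV1P (bg9YP)
open B9BackgroundsKLevelV1R (regYP335 regYP336)
open B9PinCarriersKLevelV1P (siteKernelP)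
open B9PinGeometryKLevelV1 (unitDistY)
open B9Thm311ReadingCoords (trIP IsSymmTr)
open B9CoReadingCoordsTranspose (trReForm TrIdx trBasis)
open B9CoReadingCoords (XBK)
open B9CoReadingCoordsH (XHK HcoK)
open B9Thm39ReadingCoords (basisBound39)
open B9Thm37Glue (IsTransposePair)
open B9Thm34Ext (toB6)
open B6RandomWalkHom (HasMajorantHom)
open B9RWSumsDefinitePins (PinPrims)
open B9RowSum261DefiniteFaces (rowConst261 rowConst261_nonneg)
open B6Geom246MultiLevelTorus (geomT)
open B6GlobalChartV1 (blkV1)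
open B6Ineq2142KLevelV1 (β)
open B7Prop2Explicit (unitaryUnits)
open B7Prop2SpecialUnitary (specialUnitaryUnits specialUnitaryUnits_le_unitaryUnits)
open B9Eq336RegularAtAllBondsP (regularAt_pinScale_of_regYP336)
open B9Eq3136HstarJAtPinsLetterFamily (etaDY_mul_norm_trAdjY_H1Y_JY_le_of_transpose_schemas_wR)
open B1Eq324BenfattoClassSectEMemberPrecisionDoorRecordV4PAdjCurrent
  (eq324_CsDeltaCPstY_lettersYOfRecordV4P_sectEStYOfRecordV7_trBasis_of_stmt3132Printed_P_of_adjCurrentP_of_pivotLines_onΛst_on_unit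
   eq324_CsDeltaCPstY_lettersYOfRecordV4P_sectEStYOfRecordV7_trBasis_of_stmt3132Printed_P_of_adjCurrentP_of_pivotLines_ofC2_onΛst_on_unit)

/-! ## §1  The star doors of record at the v4P letters, 𝒥-row input BY NAME from the weighted transpose schema of `H₁(U)` fed `G′_phys`; `hreg` discharged at print's class -/

section Doors

/-- ★★★ **FAMILY FORM AT PRINT's CLASS `bg9YP`, THE 𝒥-ROW INPUT (b†) BY NAME FROM NODE N06's (H\*J) ROAD** — p709207 §2's
`…_of_stmt3132Printed_P_of_adjCurrentP_of_pivotLines_onΛst_on_unit` with the per-background rows (b†) `∀ z, S z → η^{d+1}·‖(H₁(U)†J(U))(z)‖ ≤ j₁` and (c-out) (output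
support of `D̃⁽²⁾` in `S`) ELIMINATED (`S := ⊤`, `j₁ := t_{HJ}·a_T·w₁`): displayed at the theorem level instead, in node N06's species — the pins `bI ∕ hbI0 ∕ hβ1`, the
weighted transpose schema `hH1T` of the model `HcoK … (H1Y … (GpPhysY …) (𝔯 x).Δ2) U` in the regime `(bg9YP …).Reg335∕Reg336 c35 α₀ U` above `M_T`, `M_xα₀ ≤ a_T`, the weight
law `hWη`, `q : PinPrims`, the rate budget and `t_{HJ}`; r06's regularity datum at every fine bond is SUPPLIED by n06-w8's `regularAt_pinScale_of_regYP336` (`c35 ≤ 10`,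
`c_J := 10·L⁷`, `10L⁷·a_T ≤ 1`).  Per background, as before: print's class, the pivot-line smallness `δ_V` (`ℓ·2δ_V < 1`), [5]'s reality rows, the PIN, (c) locality∕size
of `D̃⁽²⁾`, the Δ_k-row `γ₀`; thresholds `max M₄ (max M_H M_T)`, `min a₀ a_T`.
[cite: Balaban1985BackgroundPropagators, p.422 (the sentence between (3.136) and (3.137)), (3.129) p.421, (3.132)–(3.133) p.422, Thm 3.12 p.423, (3.35)–(3.36) p.396,
(3.155)–(3.158) pp.427–428; Balaban1984PropagatorsII, (2.51) p.232, Lemma 2.1 (2.60)–(2.61) pp.233–234, (2.149) p.249, (2.3) p.224, Lemma 2.4 p.245; Balaban1985Averaging,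
(125)–(126) p.36, (136) p.39; Balaban1985UV3, (24) p.262; Balaban1982Higgs1, (3.24) p.616; BenfattoEtAl1978, Lemma (4.5)–(4.7) p.152 (class form; bent window, presentation
and coordinates ours)] -/
theorem eq324_CsDeltaCPstY_lettersYOfRecordV4P_sectEStYOfRecordV7_trBasis_of_stmt3132Printed_P_of_H1Schemas_of_pivotLines_onΛst_on_unit (N : ℕ) [NeZero N]
    (θ : Stage3Params) (hD : 2 ≤ θ.d₆ + 1) (Mstar : ℕ) (𝔡₂ : Dt2Y N θ Mstar)
    (𝔯 : ResY N θ Mstar) (𝔢₀ : SectEY N θ Mstar) (𝔢st : SectEStY N θ Mstar) (𝔴 : RWEY N θ Mstar) (𝔈 : ExpsY N θ Mstar) {c35 : ℝ}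
    (h26 : B9.Stmt3132Printed (θ.d₆ + 1) c35
      (geo9Y (d := θ.d₆) (ℓ := θ.ℓ₆) (hd := θ.hd') (hL := θ.hL') (b₀ := θ.b₀) (b₁ := θ.b₁) (Mstar := Mstar))
      (bg9YP (Matrix (Fin N) (Fin N) ℂ) (specialUnitaryUnits (Fin N)))
      (fun x => siteKernelP (opsYNuStOfRecordV4PE N θ Mstar 𝔯 𝔢st 𝔴 𝔈 x).QGQinv)
      (fun x => siteKernelP (opsYNuStOfRecordV4PE N θ Mstar 𝔯 𝔢st 𝔴 𝔈 x).QG1Qinv))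
    {γ₀ δV C₂ r₂ : ℝ} (hγ₀ : 0 < γ₀) (hδV : 0 ≤ δV) (hC₂ : 0 ≤ C₂)
    (hsmall : (θ.ℓ₆ : ℝ) * (2 * δV) < 1)
    (t D : ℕ) {ϰ : ℝ} (hϰ : 0 < ϰ) {p₀ σ' c κ' : ℝ} (hp₀ : 2 / 3 < p₀) (hσ : 0 < σ') (hc : 0 ≤ c) (hκ : 0 < κ') (hκσ : κ' < σ' * (t + 1))
    (hc10 : c35 ≤ 10)
    [∀ x : MemberY θ.d₆ θ.ℓ₆ θ.hd' θ.hL' θ.b₀ θ.b₁ Mstar, Fintype (geo9Y x).Site]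
    (q : PinPrims) (hq : q.OK) (Hg : MemberY θ.d₆ θ.ℓ₆ θ.hd' θ.hL' θ.b₀ θ.b₁ Mstar → Prop)
    (bI : ∀ x : MemberY θ.d₆ θ.ℓ₆ θ.hd' θ.hL' θ.b₀ θ.b₁ Mstar, FBondY x.toKIdx → IBondY x.toKIdx)
    (hbI0 : ∀ (x : MemberY θ.d₆ θ.ℓ₆ θ.hd' θ.hL' θ.b₀ θ.b₁ Mstar) (f : FBondY x.toKIdx), bI x f = bI x ⟨f.src, 0⟩)
    (hβ1 : ∀ (x : MemberY θ.d₆ θ.ℓ₆ θ.hd' θ.hL' θ.b₀ θ.b₁ Mstar) (f : FBondY x.toKIdx), (geomT x.D).dist (β x.hN x.D x.hk (bI x f)) (blkV1 x.hN x.D f) ≤ 1)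
    (𝔗 : ∀ x : MemberY θ.d₆ θ.ℓ₆ θ.hd' θ.hL' θ.b₀ θ.b₁ Mstar, (bg9Y (Matrix (Fin N) (Fin N) ℂ) (specialUnitaryUnits (Fin N)) x).Cfg →
      (XBK (TrIdx N) x.toKIdx → ℝ) →ₗ[ℝ] (XHK (TrIdx N) x.toKIdx → ℝ))
    (WT : ∀ x : MemberY θ.d₆ θ.ℓ₆ θ.hd' θ.hL' θ.b₀ θ.b₁ Mstar, IBondY x.toKIdx → ℝ) (hWT : ∀ x c, 0 ≤ WT x c)
    {w₁ : ℝ} (hw₁ : 0 ≤ w₁) (hWη : ∀ (x : MemberY θ.d₆ θ.ℓ₆ θ.hd' θ.hL' θ.b₀ θ.b₁ Mstar) (c : IBondY x.toKIdx), etaDY x * (WT x c * ((geo9Y x).len c ^ 3)⁻¹) ≤ w₁)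
    (BT δT ρR tHJ MT aT : ℝ) (hBT : 0 ≤ BT) (hρR : 0 < ρR) (hMT : 0 < MT) (haT : 0 < aT) (ha1 : 10 * ((θ.ℓ₆ + 1 : ℕ) : ℝ) ^ 7 * aT ≤ 1)
    (hδT : q.αF * ((1 - 2 * q.α) * q.δ₀) + ρR ≤ δT)
    (htHJ : N * basisBound39 (trBasis N) ^ 2 * (10 ^ 4 * ((θ.d₆ : ℝ) + 1) * (10 * ((θ.ℓ₆ + 1 : ℕ) : ℝ) ^ 7)) * (((θ.d₆ : ℝ) + 1) * Fintype.card (TrIdx N) * BT) *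
      ((((θ.ℓ₆ + 1 : ℕ) : ℝ) ^ 3) * rowConst261 (geo9Y (d := θ.d₆) (ℓ := θ.ℓ₆) (hd := θ.hd') (hL := θ.hL') (b₀ := θ.b₀) (b₁ := θ.b₁) (Mstar := Mstar)) ρR) ≤ tHJ)
    (hH1T : ∀ x : MemberY θ.d₆ θ.ℓ₆ θ.hd' θ.hL' θ.b₀ θ.b₁ Mstar, MT ≤ (geo9Y x).M → ∀ α₀ : ℝ, 0 < α₀ → (geo9Y x).M * α₀ ≤ aT →
      ∀ U : (bg9Y (Matrix (Fin N) (Fin N) ℂ) (specialUnitaryUnits (Fin N)) x).Cfg,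
        (bg9YP (Matrix (Fin N) (Fin N) ℂ) (specialUnitaryUnits (Fin N)) x).Reg335 c35 α₀ U →
        (bg9YP (Matrix (Fin N) (Fin N) ℂ) (specialUnitaryUnits (Fin N)) x).Reg336 c35 α₀ U →
          IsTransposePair (HcoK x.toKIdx (trBasis N) (bg9Y (Matrix (Fin N) (Fin N) ℂ) (specialUnitaryUnits (Fin N)) x) (fun U => U)
              (H1Y x.toKIdx (parSymY x.toKIdx) (parBY x.toKIdx) (GpPhysY x.toKIdx (parSymY x.toKIdx)) (𝔯 x).Δ2) U) (𝔗 x U) ∧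
            HasMajorantHom (g := toB6 (geo9Y x) 1 (Hg x)) (fun p : XBK (TrIdx N) x.toKIdx => bI x p.1) (fun p : XHK (TrIdx N) x.toKIdx => p.1) (𝔗 x U)
              (fun c y' => BT * WT x c * Real.exp (-(δT * (geo9Y x).dist c y')))) :
    ∃ M₄ δ a₀ : ℝ, 0 < M₄ ∧ 0 < δ ∧ 0 < a₀ ∧ ∃ b₁ : ℝ, ∀ b₀ : ℝ, b₁ < b₀ → ∃ C : ℝ, 0 ≤ C ∧ ∀ η : ℝ, 0 < η → η ≤ 1 →
      ∀ (x : MemberY θ.d₆ θ.ℓ₆ θ.hd' θ.hL' θ.b₀ θ.b₁ Mstar) [DecidableEq (IBondY x.toKIdx)], M₄ ≤ (geo9Y x).M →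
      ∀ α₀ : ℝ, 0 < α₀ → (geo9Y x).M * α₀ ≤ a₀ →
      ∀ (U : CfgY (Matrix (Fin N) (Fin N) ℂ) x.toKIdx),
        (bg9YP (Matrix (Fin N) (Fin N) ℂ) (specialUnitaryUnits (Fin N)) x).Reg335 c35 α₀ U →
        (bg9YP (Matrix (Fin N) (Fin N) ℂ) (specialUnitaryUnits (Fin N)) x).Reg336 c35 α₀ U →
        (∀ c' : CBondStY x, ¬ GoodY x c'.1.1 → ∀ i : ℕ, i < θ.ℓ₆ →
          ‖((avYOfRecord x U ⟨ofZ x (labK x c'.1.1 + (i : ℤ) • unitVec c'.1.2), c'.1.2⟩ : (Matrix (Fin N) (Fin N) ℂ)ˣ) :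
              Matrix (Fin N) (Fin N) ℂ) - 1‖ ≤ δV) →
        IsSymmTr (fun _ => (1 : ℝ)) ((𝔯 x).Δ2 U) → IsSymmTr (fun _ => (1 : ℝ)) ((𝔢₀ x).D2J U) →
      ∀ {σ : Type} [Fintype σ] [DecidableEq σ] [Nonempty σ] (ι : σ → IBondY x.toKIdx), Function.Injective ι → (∀ s, lamTstY x (ι s)) →
        (𝔢₀ x).D2J U = d2JOfY (trDualMatY N) x.toKIdx (parSymY x.toKIdx) (parBY x.toKIdx) (GpPhysY x.toKIdx (parSymY x.toKIdx)) (𝔯 x).Δ2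
          (𝔡₂ x).form U →
        (∀ (u v : IBondY x.toKIdx) (E a : Matrix (Fin N) (Fin N) ℂ), r₂ < unitDistY x u v → (𝔡₂ x).form U (Pi.single v E) (Pi.single u a) = 0) →
        (∀ (u v : IBondY x.toKIdx) (E a : Matrix (Fin N) (Fin N) ℂ), ∑ z, ‖(𝔡₂ x).form U (Pi.single v E) (Pi.single u a) z‖ ≤ C₂ * ‖E‖ * ‖a‖) →
        (∀ B : IBondY x.toKIdx → Matrix (Fin N) (Fin N) ℂ, (∀ q, ¬ inΛstY x q → B q = 0) → (∀ q, IsAxialY x q → B q = 0) →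
          (∀ c' : CBondStY x, Q1Y x (avYOfRecord x) U c'.1 B = 0) →
          γ₀ * trIP (fun _ => (1 : ℝ)) B B ≤
            trIP (fun _ => (1 : ℝ)) B (deltaKPstY x (lettersYOfRecordV4P N θ Mstar 𝔯 x) (sectEStYOfRecordV7 N θ Mstar 𝔢₀ x) U B)) →
      ∃ (Λ : Finset (B1Eq324BenfattoLemma.Site (θ.d₆ + 1 + (θ.d₆ + 1) + 1))) (e' : σ × TrIdx N ≃ ↥Λ),
        ((gaussianFieldOfKernel fun u w => if h : u ∈ Λ ∧ w ∈ Λ then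
            ((Matrix.reindex e' e'
              (Matrix.of fun p q : σ × TrIdx N =>
                  trReForm (trBasis N p.2) (((CsDeltaCPstY x (lettersYOfRecordV4P N θ Mstar 𝔯 x)
            (sectEStYOfRecordV7 N θ Mstar 𝔢₀ x) U).restrictScalars ℝ)
                    (Pi.single (ι q.1) (trBasis N q.2)) (ι p.1))))⁻¹ :
                Matrix ↥Λ ↥Λ ℝ) ⟨u, h.1⟩ ⟨w, h.2⟩ else 0).map
            (fun (z : B1Eq324BenfattoLemma.Site (θ.d₆ + 1 + (θ.d₆ + 1) + 1) → ℝ) (q : σ × TrIdx N) => z ((e' q : ↥Λ) : B1Eq324BenfattoLemma.Site (θ.d₆ + 1 + (θ.d₆ + 1) + 1))) =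
          gaussianFieldOfKernel fun p q =>
            ((Matrix.of fun p q : σ × TrIdx N =>
                trReForm (trBasis N p.2) (((CsDeltaCPstY x (lettersYOfRecordV4P N θ Mstar 𝔯 x)
            (sectEStYOfRecordV7 N θ Mstar 𝔢₀ x) U).restrictScalars ℝ)
                  (Pi.single (ι q.1) (trBasis N q.2)) (ι p.1)))⁻¹ :
              Matrix (σ × TrIdx N) (σ × TrIdx N) ℝ) p q) ∧
        (∀ p : ℝ, 0 ≤ p →
          ((fun (z : B1Eq324BenfattoLemma.Site (θ.d₆ + 1 + (θ.d₆ + 1) + 1) → ℝ) (q : σ × TrIdx N) => z ((e' q : ↥Λ) : B1Eq324BenfattoLemma.Site (θ.d₆ + 1 + (θ.d₆ + 1) + 1))) ⁻¹'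
              {ω : σ × TrIdx N → ℝ | ∀ q, |ω q| ≤ p}) =ᵐ[gaussianFieldOfKernel fun u w => if h : u ∈ Λ ∧ w ∈ Λ then
                ((Matrix.reindex e' e'
                  (Matrix.of fun p q : σ × TrIdx N =>
                      trReForm (trBasis N p.2) (((CsDeltaCPstY x (lettersYOfRecordV4P N θ Mstar 𝔯 x)
            (sectEStYOfRecordV7 N θ Mstar 𝔢₀ x) U).restrictScalars ℝ)
                        (Pi.single (ι q.1) (trBasis N q.2)) (ι p.1))))⁻¹ :
                    Matrix ↥Λ ↥Λ ℝ) ⟨u, h.1⟩ ⟨w, h.2⟩ else 0]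
            smallFieldSet Λ p) ∧
        ∀ (s : ℕ) (I J : Finset (B1Eq324BenfattoLemma.Site (θ.d₆ + 1 + (θ.d₆ + 1) + 1))) (𝔞 : Coef (θ.d₆ + 1 + (θ.d₆ + 1) + 1)),
          I.Nonempty → J ⊆ I → J ⊆ Λ → coefSup s D 𝔞 J ≤ c * η ^ σ' →
          0 < ∫ z, cutoffBoltzmann (hamiltonian s D ϰ 𝔞 J) I (B10.pFun b₀ p₀ η) z ∂(gaussianFieldOfKernel fun u w => if h : u ∈ Λ ∧ w ∈ Λ then
              ((Matrix.reindex e' e'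
                (Matrix.of fun p q : σ × TrIdx N =>
                    trReForm (trBasis N p.2) (((CsDeltaCPstY x (lettersYOfRecordV4P N θ Mstar 𝔯 x)
            (sectEStYOfRecordV7 N θ Mstar 𝔢₀ x) U).restrictScalars ℝ)
                      (Pi.single (ι q.1) (trBasis N q.2)) (ι p.1))))⁻¹ :
                  Matrix ↥Λ ↥Λ ℝ) ⟨u, h.1⟩ ⟨w, h.2⟩ else 0) ∧
            |Real.log (∫ z, cutoffBoltzmann (hamiltonian s D ϰ 𝔞 J) I (B10.pFun b₀ p₀ η) z ∂(gaussianFieldOfKernel fun u w =>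
                if h : u ∈ Λ ∧ w ∈ Λ then
                  ((Matrix.reindex e' e'
                    (Matrix.of fun p q : σ × TrIdx N =>
                        trReForm (trBasis N p.2) (((CsDeltaCPstY x (lettersYOfRecordV4P N θ Mstar 𝔯 x)
            (sectEStYOfRecordV7 N θ Mstar 𝔢₀ x) U).restrictScalars ℝ)
                          (Pi.single (ι q.1) (trBasis N q.2)) (ι p.1))))⁻¹ :
                      Matrix ↥Λ ↥Λ ℝ) ⟨u, h.1⟩ ⟨w, h.2⟩ else 0)) -
              cumulantSum (gaussianFieldOfKernel fun u w => if h : u ∈ Λ ∧ w ∈ Λ then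
                  ((Matrix.reindex e' e'
                    (Matrix.of fun p q : σ × TrIdx N =>
                        trReForm (trBasis N p.2) (((CsDeltaCPstY x (lettersYOfRecordV4P N θ Mstar 𝔯 x)
            (sectEStYOfRecordV7 N θ Mstar 𝔢₀ x) U).restrictScalars ℝ)
                          (Pi.single (ι q.1) (trBasis N q.2)) (ι p.1))))⁻¹ :
                      Matrix ↥Λ ↥Λ ℝ) ⟨u, h.1⟩ ⟨w, h.2⟩ else 0)
                (hamiltonian s D ϰ 𝔞 J) t| ≤ C * η ^ κ' * I.card := by
  -- the (H\*J) road: the 𝒥-row input (b†) BY NAME from the weighted transpose schema `hH1T`, `hreg` DISCHARGED at print's class (n06-w8 F12)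
  have hcJ : (0 : ℝ) ≤ 10 * ((θ.ℓ₆ + 1 : ℕ) : ℝ) ^ 7 := by positivity
  obtain ⟨MH, hMH⟩ := etaDY_mul_norm_trAdjY_H1Y_JY_le_of_transpose_schemas_wR (N := N) q hq Hg
    (regYP335 (Matrix (Fin N) (Fin N) ℂ) (specialUnitaryUnits (Fin N))) (regYP336 (Matrix (Fin N) (Fin N) ℂ) (specialUnitaryUnits (Fin N))) c35 𝔯
    bI hbI0 𝔗 WT hWT hWη (10 * ((θ.ℓ₆ + 1 : ℕ) : ℝ) ^ 7) BT δT ρR tHJ MT aT hcJ hBT hρR hMT ha1 hδT htHJ hH1T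
    (fun x _ α₀ hα _ U _ hU' μ s => regularAt_pinScale_of_regYP336 x hc10 hα.le hU' (bI x) (hβ1 x) μ ⟨s, 0⟩)
  have htHJ0 : 0 ≤ tHJ := le_trans (by
    have := rowConst261_nonneg (geo9Y (d := θ.d₆) (ℓ := θ.ℓ₆) (hd := θ.hd') (hL := θ.hL') (b₀ := θ.b₀) (b₁ := θ.b₁) (Mstar := Mstar)) ρR
    positivity) htHJ
  have hj₁ : 0 ≤ tHJ * aT * w₁ := mul_nonneg (mul_nonneg htHJ0 haT.le) hw₁
  obtain ⟨M₄, δ, a₀, hM₄, hδ, ha₀, b₁, hb₁⟩ := eq324_CsDeltaCPstY_lettersYOfRecordV4P_sectEStYOfRecordV7_trBasis_of_stmt3132Printed_P_of_adjCurrentP_of_pivotLines_onΛst_on_unit N θ hD Mstar 𝔡₂ 𝔯 𝔢₀ 𝔢st 𝔴 𝔈 h26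
    (r₂ := r₂) (j₁ := tHJ * aT * w₁) hγ₀ hδV hj₁ hC₂ hsmall t D hϰ hp₀ hσ hc hκ hκσ
  refine ⟨max M₄ (max MH MT), δ, min a₀ aT, lt_max_of_lt_left hM₄, hδ, lt_min ha₀ haT, b₁, fun b₀ hb₀ => ?_⟩
  obtain ⟨C, hC, hE⟩ := hb₁ b₀ hb₀
  refine ⟨C, hC, ?_⟩
  intro η hη hηle x _ hMx α₀ hα₀ hMa U h335 h336 hV hΔ2 hD2J σ _ _ _ ι hι hιT hpin hDloc hDsz hco
  have hM₄x : M₄ ≤ (geo9Y x).M := (le_max_left _ _).trans hMx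
  have hMHx : MH ≤ (geo9Y x).M := ((le_max_left _ _).trans (le_max_right M₄ _)).trans hMx
  have hMTx : MT ≤ (geo9Y x).M := ((le_max_right _ _).trans (le_max_right M₄ _)).trans hMx
  have ha₀x : (geo9Y x).M * α₀ ≤ a₀ := hMa.trans (min_le_left _ _)
  have haTx : (geo9Y x).M * α₀ ≤ aT := hMa.trans (min_le_right _ _)
  exact hE η hη hηle x hM₄x α₀ hα₀ ha₀x U h335 h336 hV hΔ2 hD2J ι hι hιT hpin (fun _ => True)
    (fun z _ => hMH x hMHx hMTx α₀ hα₀ haTx U h335 h336 z) (fun _ _ _ _ _ _ _ _ => trivial) hDloc hDsz hco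


/-- ★★★★ **THE STAR DOOR OF RECORD MODULO NODE N06's SOCKET OF RECORD, THE 𝒥-ROW INPUT BY NAME FROM NODE N06's (H\*J) ROAD** — §1's family form at
`h26 := h06.s3132`, `c35 := c35Y = 10` (`h06 : B9LeafX (Y9OfRecordP N θ M⋆ (opsYNuStOfRecordV4PE N θ M⋆ 𝔯 𝔢st 𝔴 𝔈))`).  What stands between this door and N08's row
`h324c`: node N06's certificate (`h06`) AND its letters for `H₁` (the weighted transpose schema `hH1T` — Thm 3.12-species content of node N06, displayed here in node N06's
own currency), [5]'s letters (reality, the pin, (c)), G-B9-09 (`γ₀`), the pivot-line row of NODE 00's dictionary and the IDENT — no raw (3.136) row any more.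
[cite: Balaban1985BackgroundPropagators, p.422 (the sentence between (3.136) and (3.137)), (3.129) p.421, (3.132)–(3.133) p.422, Thm 3.12 p.423, (3.35)–(3.36) p.396,
(3.155)–(3.158) pp.427–428, Thms 3.1–3.15 pp.397–432 (the leaf); Balaban1984PropagatorsII, (2.51) p.232, Lemma 2.1 (2.60)–(2.61) pp.233–234, (2.149) p.249, (2.3) p.224,
Lemma 2.4 p.245; Balaban1985Averaging, (125)–(126) p.36, (136) p.39; Balaban1985UV3, (24) p.262; Balaban1982Higgs1, (3.24) p.616; BenfattoEtAl1978, Lemma (4.5)–(4.7) p.152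
(class form; bent window, presentation and coordinates ours)] -/
theorem eq324_CsDeltaCPstY_lettersYOfRecordV4P_sectEStYOfRecordV7_trBasis_of_b9LeafX_of_H1Schemas_of_pivotLines_onΛst_on_unit (N : ℕ) [NeZero N]
    (θ : Stage3Params) (hD : 2 ≤ θ.d₆ + 1) (Mstar : ℕ) (𝔡₂ : Dt2Y N θ Mstar)
    (𝔯 : ResY N θ Mstar) (𝔢₀ : SectEY N θ Mstar) (𝔢st : SectEStY N θ Mstar) (𝔴 : RWEY N θ Mstar) (𝔈 : ExpsY N θ Mstar) 
    (h06 : B9LeafX (Y9OfRecordP N θ Mstar (opsYNuStOfRecordV4PE N θ Mstar 𝔯 𝔢st 𝔴 𝔈)))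
    {γ₀ δV C₂ r₂ : ℝ} (hγ₀ : 0 < γ₀) (hδV : 0 ≤ δV) (hC₂ : 0 ≤ C₂)
    (hsmall : (θ.ℓ₆ : ℝ) * (2 * δV) < 1)
    (t D : ℕ) {ϰ : ℝ} (hϰ : 0 < ϰ) {p₀ σ' c κ' : ℝ} (hp₀ : 2 / 3 < p₀) (hσ : 0 < σ') (hc : 0 ≤ c) (hκ : 0 < κ') (hκσ : κ' < σ' * (t + 1))
    [∀ x : MemberY θ.d₆ θ.ℓ₆ θ.hd' θ.hL' θ.b₀ θ.b₁ Mstar, Fintype (geo9Y x).Site]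
    (q : PinPrims) (hq : q.OK) (Hg : MemberY θ.d₆ θ.ℓ₆ θ.hd' θ.hL' θ.b₀ θ.b₁ Mstar → Prop)
    (bI : ∀ x : MemberY θ.d₆ θ.ℓ₆ θ.hd' θ.hL' θ.b₀ θ.b₁ Mstar, FBondY x.toKIdx → IBondY x.toKIdx)
    (hbI0 : ∀ (x : MemberY θ.d₆ θ.ℓ₆ θ.hd' θ.hL' θ.b₀ θ.b₁ Mstar) (f : FBondY x.toKIdx), bI x f = bI x ⟨f.src, 0⟩)
    (hβ1 : ∀ (x : MemberY θ.d₆ θ.ℓ₆ θ.hd' θ.hL' θ.b₀ θ.b₁ Mstar) (f : FBondY x.toKIdx), (geomT x.D).dist (β x.hN x.D x.hk (bI x f)) (blkV1 x.hN x.D f) ≤ 1)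
    (𝔗 : ∀ x : MemberY θ.d₆ θ.ℓ₆ θ.hd' θ.hL' θ.b₀ θ.b₁ Mstar, (bg9Y (Matrix (Fin N) (Fin N) ℂ) (specialUnitaryUnits (Fin N)) x).Cfg →
      (XBK (TrIdx N) x.toKIdx → ℝ) →ₗ[ℝ] (XHK (TrIdx N) x.toKIdx → ℝ))
    (WT : ∀ x : MemberY θ.d₆ θ.ℓ₆ θ.hd' θ.hL' θ.b₀ θ.b₁ Mstar, IBondY x.toKIdx → ℝ) (hWT : ∀ x c, 0 ≤ WT x c)
    {w₁ : ℝ} (hw₁ : 0 ≤ w₁) (hWη : ∀ (x : MemberY θ.d₆ θ.ℓ₆ θ.hd' θ.hL' θ.b₀ θ.b₁ Mstar) (c : IBondY x.toKIdx), etaDY x * (WT x c * ((geo9Y x).len c ^ 3)⁻¹) ≤ w₁)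
    (BT δT ρR tHJ MT aT : ℝ) (hBT : 0 ≤ BT) (hρR : 0 < ρR) (hMT : 0 < MT) (haT : 0 < aT) (ha1 : 10 * ((θ.ℓ₆ + 1 : ℕ) : ℝ) ^ 7 * aT ≤ 1)
    (hδT : q.αF * ((1 - 2 * q.α) * q.δ₀) + ρR ≤ δT)
    (htHJ : N * basisBound39 (trBasis N) ^ 2 * (10 ^ 4 * ((θ.d₆ : ℝ) + 1) * (10 * ((θ.ℓ₆ + 1 : ℕ) : ℝ) ^ 7)) * (((θ.d₆ : ℝ) + 1) * Fintype.card (TrIdx N) * BT) *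
      ((((θ.ℓ₆ + 1 : ℕ) : ℝ) ^ 3) * rowConst261 (geo9Y (d := θ.d₆) (ℓ := θ.ℓ₆) (hd := θ.hd') (hL := θ.hL') (b₀ := θ.b₀) (b₁ := θ.b₁) (Mstar := Mstar)) ρR) ≤ tHJ)
    (hH1T : ∀ x : MemberY θ.d₆ θ.ℓ₆ θ.hd' θ.hL' θ.b₀ θ.b₁ Mstar, MT ≤ (geo9Y x).M → ∀ α₀ : ℝ, 0 < α₀ → (geo9Y x).M * α₀ ≤ aT →
      ∀ U : (bg9Y (Matrix (Fin N) (Fin N) ℂ) (specialUnitaryUnits (Fin N)) x).Cfg,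
        (bg9YP (Matrix (Fin N) (Fin N) ℂ) (specialUnitaryUnits (Fin N)) x).Reg335 B9PinGeometryKLevelV1.c35Y α₀ U →
        (bg9YP (Matrix (Fin N) (Fin N) ℂ) (specialUnitaryUnits (Fin N)) x).Reg336 B9PinGeometryKLevelV1.c35Y α₀ U →
          IsTransposePair (HcoK x.toKIdx (trBasis N) (bg9Y (Matrix (Fin N) (Fin N) ℂ) (specialUnitaryUnits (Fin N)) x) (fun U => U)
              (H1Y x.toKIdx (parSymY x.toKIdx) (parBY x.toKIdx) (GpPhysY x.toKIdx (parSymY x.toKIdx)) (𝔯 x).Δ2) U) (𝔗 x U) ∧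
            HasMajorantHom (g := toB6 (geo9Y x) 1 (Hg x)) (fun p : XBK (TrIdx N) x.toKIdx => bI x p.1) (fun p : XHK (TrIdx N) x.toKIdx => p.1) (𝔗 x U)
              (fun c y' => BT * WT x c * Real.exp (-(δT * (geo9Y x).dist c y')))) :
    ∃ M₄ δ a₀ : ℝ, 0 < M₄ ∧ 0 < δ ∧ 0 < a₀ ∧ ∃ b₁ : ℝ, ∀ b₀ : ℝ, b₁ < b₀ → ∃ C : ℝ, 0 ≤ C ∧ ∀ η : ℝ, 0 < η → η ≤ 1 →
      ∀ (x : MemberY θ.d₆ θ.ℓ₆ θ.hd' θ.hL' θ.b₀ θ.b₁ Mstar) [DecidableEq (IBondY x.toKIdx)], M₄ ≤ (geo9Y x).M →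
      ∀ α₀ : ℝ, 0 < α₀ → (geo9Y x).M * α₀ ≤ a₀ →
      ∀ (U : CfgY (Matrix (Fin N) (Fin N) ℂ) x.toKIdx),
        (bg9YP (Matrix (Fin N) (Fin N) ℂ) (specialUnitaryUnits (Fin N)) x).Reg335 B9PinGeometryKLevelV1.c35Y α₀ U →
        (bg9YP (Matrix (Fin N) (Fin N) ℂ) (specialUnitaryUnits (Fin N)) x).Reg336 B9PinGeometryKLevelV1.c35Y α₀ U →
        (∀ c' : CBondStY x, ¬ GoodY x c'.1.1 → ∀ i : ℕ, i < θ.ℓ₆ →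
          ‖((avYOfRecord x U ⟨ofZ x (labK x c'.1.1 + (i : ℤ) • unitVec c'.1.2), c'.1.2⟩ : (Matrix (Fin N) (Fin N) ℂ)ˣ) :
              Matrix (Fin N) (Fin N) ℂ) - 1‖ ≤ δV) →
        IsSymmTr (fun _ => (1 : ℝ)) ((𝔯 x).Δ2 U) → IsSymmTr (fun _ => (1 : ℝ)) ((𝔢₀ x).D2J U) →
      ∀ {σ : Type} [Fintype σ] [DecidableEq σ] [Nonempty σ] (ι : σ → IBondY x.toKIdx), Function.Injective ι → (∀ s, lamTstY x (ι s)) →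
        (𝔢₀ x).D2J U = d2JOfY (trDualMatY N) x.toKIdx (parSymY x.toKIdx) (parBY x.toKIdx) (GpPhysY x.toKIdx (parSymY x.toKIdx)) (𝔯 x).Δ2
          (𝔡₂ x).form U →
        (∀ (u v : IBondY x.toKIdx) (E a : Matrix (Fin N) (Fin N) ℂ), r₂ < unitDistY x u v → (𝔡₂ x).form U (Pi.single v E) (Pi.single u a) = 0) →
        (∀ (u v : IBondY x.toKIdx) (E a : Matrix (Fin N) (Fin N) ℂ), ∑ z, ‖(𝔡₂ x).form U (Pi.single v E) (Pi.single u a) z‖ ≤ C₂ * ‖E‖ * ‖a‖) →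
        (∀ B : IBondY x.toKIdx → Matrix (Fin N) (Fin N) ℂ, (∀ q, ¬ inΛstY x q → B q = 0) → (∀ q, IsAxialY x q → B q = 0) →
          (∀ c' : CBondStY x, Q1Y x (avYOfRecord x) U c'.1 B = 0) →
          γ₀ * trIP (fun _ => (1 : ℝ)) B B ≤
            trIP (fun _ => (1 : ℝ)) B (deltaKPstY x (lettersYOfRecordV4P N θ Mstar 𝔯 x) (sectEStYOfRecordV7 N θ Mstar 𝔢₀ x) U B)) →
      ∃ (Λ : Finset (B1Eq324BenfattoLemma.Site (θ.d₆ + 1 + (θ.d₆ + 1) + 1))) (e' : σ × TrIdx N ≃ ↥Λ),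
        ((gaussianFieldOfKernel fun u w => if h : u ∈ Λ ∧ w ∈ Λ then
            ((Matrix.reindex e' e'
              (Matrix.of fun p q : σ × TrIdx N =>
                  trReForm (trBasis N p.2) (((CsDeltaCPstY x (lettersYOfRecordV4P N θ Mstar 𝔯 x)
            (sectEStYOfRecordV7 N θ Mstar 𝔢₀ x) U).restrictScalars ℝ)
                    (Pi.single (ι q.1) (trBasis N q.2)) (ι p.1))))⁻¹ :
                Matrix ↥Λ ↥Λ ℝ) ⟨u, h.1⟩ ⟨w, h.2⟩ else 0).map
            (fun (z : B1Eq324BenfattoLemma.Site (θ.d₆ + 1 + (θ.d₆ + 1) + 1) → ℝ) (q : σ × TrIdx N) => z ((e' q : ↥Λ) : B1Eq324BenfattoLemma.Site (θ.d₆ + 1 + (θ.d₆ + 1) + 1))) =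
          gaussianFieldOfKernel fun p q =>
            ((Matrix.of fun p q : σ × TrIdx N =>
                trReForm (trBasis N p.2) (((CsDeltaCPstY x (lettersYOfRecordV4P N θ Mstar 𝔯 x)
            (sectEStYOfRecordV7 N θ Mstar 𝔢₀ x) U).restrictScalars ℝ)
                  (Pi.single (ι q.1) (trBasis N q.2)) (ι p.1)))⁻¹ :
              Matrix (σ × TrIdx N) (σ × TrIdx N) ℝ) p q) ∧
        (∀ p : ℝ, 0 ≤ p →
          ((fun (z : B1Eq324BenfattoLemma.Site (θ.d₆ + 1 + (θ.d₆ + 1) + 1) → ℝ) (q : σ × TrIdx N) => z ((e' q : ↥Λ) : B1Eq324BenfattoLemma.Site (θ.d₆ + 1 + (θ.d₆ + 1) + 1))) ⁻¹'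
              {ω : σ × TrIdx N → ℝ | ∀ q, |ω q| ≤ p}) =ᵐ[gaussianFieldOfKernel fun u w => if h : u ∈ Λ ∧ w ∈ Λ then
                ((Matrix.reindex e' e'
                  (Matrix.of fun p q : σ × TrIdx N =>
                      trReForm (trBasis N p.2) (((CsDeltaCPstY x (lettersYOfRecordV4P N θ Mstar 𝔯 x)
            (sectEStYOfRecordV7 N θ Mstar 𝔢₀ x) U).restrictScalars ℝ)
                        (Pi.single (ι q.1) (trBasis N q.2)) (ι p.1))))⁻¹ :
                    Matrix ↥Λ ↥Λ ℝ) ⟨u, h.1⟩ ⟨w, h.2⟩ else 0]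
            smallFieldSet Λ p) ∧
        ∀ (s : ℕ) (I J : Finset (B1Eq324BenfattoLemma.Site (θ.d₆ + 1 + (θ.d₆ + 1) + 1))) (𝔞 : Coef (θ.d₆ + 1 + (θ.d₆ + 1) + 1)),
          I.Nonempty → J ⊆ I → J ⊆ Λ → coefSup s D 𝔞 J ≤ c * η ^ σ' →
          0 < ∫ z, cutoffBoltzmann (hamiltonian s D ϰ 𝔞 J) I (B10.pFun b₀ p₀ η) z ∂(gaussianFieldOfKernel fun u w => if h : u ∈ Λ ∧ w ∈ Λ then
              ((Matrix.reindex e' e'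
                (Matrix.of fun p q : σ × TrIdx N =>
                    trReForm (trBasis N p.2) (((CsDeltaCPstY x (lettersYOfRecordV4P N θ Mstar 𝔯 x)
            (sectEStYOfRecordV7 N θ Mstar 𝔢₀ x) U).restrictScalars ℝ)
                      (Pi.single (ι q.1) (trBasis N q.2)) (ι p.1))))⁻¹ :
                  Matrix ↥Λ ↥Λ ℝ) ⟨u, h.1⟩ ⟨w, h.2⟩ else 0) ∧
            |Real.log (∫ z, cutoffBoltzmann (hamiltonian s D ϰ 𝔞 J) I (B10.pFun b₀ p₀ η) z ∂(gaussianFieldOfKernel fun u w =>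
                if h : u ∈ Λ ∧ w ∈ Λ then
                  ((Matrix.reindex e' e'
                    (Matrix.of fun p q : σ × TrIdx N =>
                        trReForm (trBasis N p.2) (((CsDeltaCPstY x (lettersYOfRecordV4P N θ Mstar 𝔯 x)
            (sectEStYOfRecordV7 N θ Mstar 𝔢₀ x) U).restrictScalars ℝ)
                          (Pi.single (ι q.1) (trBasis N q.2)) (ι p.1))))⁻¹ :
                      Matrix ↥Λ ↥Λ ℝ) ⟨u, h.1⟩ ⟨w, h.2⟩ else 0)) -
              cumulantSum (gaussianFieldOfKernel fun u w => if h : u ∈ Λ ∧ w ∈ Λ then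
                  ((Matrix.reindex e' e'
                    (Matrix.of fun p q : σ × TrIdx N =>
                        trReForm (trBasis N p.2) (((CsDeltaCPstY x (lettersYOfRecordV4P N θ Mstar 𝔯 x)
            (sectEStYOfRecordV7 N θ Mstar 𝔢₀ x) U).restrictScalars ℝ)
                          (Pi.single (ι q.1) (trBasis N q.2)) (ι p.1))))⁻¹ :
                      Matrix ↥Λ ↥Λ ℝ) ⟨u, h.1⟩ ⟨w, h.2⟩ else 0)
                (hamiltonian s D ϰ 𝔞 J) t| ≤ C * η ^ κ' * I.card :=
  eq324_CsDeltaCPstY_lettersYOfRecordV4P_sectEStYOfRecordV7_trBasis_of_stmt3132Printed_P_of_H1Schemas_of_pivotLines_onΛst_on_unit N θ hD Mstar 𝔡₂ 𝔯 𝔢₀ 𝔢st 𝔴 𝔈 h06.s3132 hγ₀ hδV hC₂ hsmall t D hϰ hp₀ hσ hc hκ hκσ (by show B9PinGeometryKLevelV1.c35Y ≤ 10; norm_num [B9PinGeometryKLevelV1.c35Y])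
    q hq Hg bI hbI0 hβ1 𝔗 WT hWT hw₁ hWη BT δT ρR tHJ MT aT hBT hρR hMT haT ha1 hδT htHJ hH1T

end Doors

/-! ## §2  Over `𝔯 := resYOfC2 𝔠` ([5]'s `C⁽²⁾`): the same doors, reality READ FROM [5]'s letter properties -/

section DoorsC2

/-- ★★★ **FAMILY FORM AT PRINT's CLASS over `𝔯 := resYOfC2 𝔠`, THE 𝒥-ROW INPUT BY NAME FROM NODE N06's (H\*J) ROAD, REALITY FROM [5]'s LETTERS** — p709207 §3's
`…_of_stmt3132Printed_P_of_adjCurrentP_of_pivotLines_ofC2_onΛst_on_unit` with (b†)∕(c-out) ELIMINATED as in §1 (the schema `hH1T` now for the model of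
`H1Y … (GpPhysY …) (resYOfC2 N θ M⋆ 𝔠 x).Δ2`); displayed per background: print's class, the pivot-line row, [5]'s LETTER reality of `C⁽²⁾(U)` and `D̃⁽²⁾(U)`, the PIN,
(c), the Δ_k-row `γ₀`.
[cite: Balaban1985BackgroundPropagators, p.422 (the sentence between (3.136) and (3.137)), (3.129) p.421, (3.132)–(3.134) p.422, Thm 3.11 p.416, Thm 3.12 p.423,
(3.35)–(3.36) p.396, (3.155)–(3.158) pp.427–428; Balaban1984PropagatorsII, (2.51) p.232, Lemma 2.1 (2.60)–(2.61) pp.233–234, (2.149) p.249, (2.3) p.224, Lemma 2.4 p.245;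
Balaban1985Averaging, (125)–(126) p.36, (136) p.39; Balaban1985UV3, (24) p.262; Balaban1982Higgs1, (3.24) p.616; BenfattoEtAl1978, Lemma (4.5)–(4.7) p.152 (class form;
bent window, presentation and coordinates ours)] -/
theorem eq324_CsDeltaCPstY_lettersYOfRecordV4P_sectEStYOfRecordV7_trBasis_of_stmt3132Printed_P_of_H1Schemas_of_pivotLines_ofC2_onΛst_on_unit (N : ℕ) [NeZero N]
    (θ : Stage3Params) (hD : 2 ≤ θ.d₆ + 1) (Mstar : ℕ) (𝔠 : C2Y N θ Mstar) (𝔡₂ : Dt2Y N θ Mstar)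
    (𝔢₀ : SectEY N θ Mstar) (𝔢st : SectEStY N θ Mstar) (𝔴 : RWEY N θ Mstar) (𝔈 : ExpsY N θ Mstar) {c35 : ℝ}
    (h26 : B9.Stmt3132Printed (θ.d₆ + 1) c35
      (geo9Y (d := θ.d₆) (ℓ := θ.ℓ₆) (hd := θ.hd') (hL := θ.hL') (b₀ := θ.b₀) (b₁ := θ.b₁) (Mstar := Mstar))
      (bg9YP (Matrix (Fin N) (Fin N) ℂ) (specialUnitaryUnits (Fin N)))
      (fun x => siteKernelP (opsYNuStOfRecordV4PE N θ Mstar (resYOfC2 N θ Mstar 𝔠) 𝔢st 𝔴 𝔈 x).QGQinv)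
      (fun x => siteKernelP (opsYNuStOfRecordV4PE N θ Mstar (resYOfC2 N θ Mstar 𝔠) 𝔢st 𝔴 𝔈 x).QG1Qinv))
    {γ₀ δV C₂ r₂ : ℝ} (hγ₀ : 0 < γ₀) (hδV : 0 ≤ δV) (hC₂ : 0 ≤ C₂)
    (hsmall : (θ.ℓ₆ : ℝ) * (2 * δV) < 1)
    (t D : ℕ) {ϰ : ℝ} (hϰ : 0 < ϰ) {p₀ σ' c κ' : ℝ} (hp₀ : 2 / 3 < p₀) (hσ : 0 < σ') (hc : 0 ≤ c) (hκ : 0 < κ') (hκσ : κ' < σ' * (t + 1))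
    (hc10 : c35 ≤ 10)
    [∀ x : MemberY θ.d₆ θ.ℓ₆ θ.hd' θ.hL' θ.b₀ θ.b₁ Mstar, Fintype (geo9Y x).Site]
    (q : PinPrims) (hq : q.OK) (Hg : MemberY θ.d₆ θ.ℓ₆ θ.hd' θ.hL' θ.b₀ θ.b₁ Mstar → Prop)
    (bI : ∀ x : MemberY θ.d₆ θ.ℓ₆ θ.hd' θ.hL' θ.b₀ θ.b₁ Mstar, FBondY x.toKIdx → IBondY x.toKIdx)
    (hbI0 : ∀ (x : MemberY θ.d₆ θ.ℓ₆ θ.hd' θ.hL' θ.b₀ θ.b₁ Mstar) (f : FBondY x.toKIdx), bI x f = bI x ⟨f.src, 0⟩)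
    (hβ1 : ∀ (x : MemberY θ.d₆ θ.ℓ₆ θ.hd' θ.hL' θ.b₀ θ.b₁ Mstar) (f : FBondY x.toKIdx), (geomT x.D).dist (β x.hN x.D x.hk (bI x f)) (blkV1 x.hN x.D f) ≤ 1)
    (𝔗 : ∀ x : MemberY θ.d₆ θ.ℓ₆ θ.hd' θ.hL' θ.b₀ θ.b₁ Mstar, (bg9Y (Matrix (Fin N) (Fin N) ℂ) (specialUnitaryUnits (Fin N)) x).Cfg →
      (XBK (TrIdx N) x.toKIdx → ℝ) →ₗ[ℝ] (XHK (TrIdx N) x.toKIdx → ℝ))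
    (WT : ∀ x : MemberY θ.d₆ θ.ℓ₆ θ.hd' θ.hL' θ.b₀ θ.b₁ Mstar, IBondY x.toKIdx → ℝ) (hWT : ∀ x c, 0 ≤ WT x c)
    {w₁ : ℝ} (hw₁ : 0 ≤ w₁) (hWη : ∀ (x : MemberY θ.d₆ θ.ℓ₆ θ.hd' θ.hL' θ.b₀ θ.b₁ Mstar) (c : IBondY x.toKIdx), etaDY x * (WT x c * ((geo9Y x).len c ^ 3)⁻¹) ≤ w₁)
    (BT δT ρR tHJ MT aT : ℝ) (hBT : 0 ≤ BT) (hρR : 0 < ρR) (hMT : 0 < MT) (haT : 0 < aT) (ha1 : 10 * ((θ.ℓ₆ + 1 : ℕ) : ℝ) ^ 7 * aT ≤ 1)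
    (hδT : q.αF * ((1 - 2 * q.α) * q.δ₀) + ρR ≤ δT)
    (htHJ : N * basisBound39 (trBasis N) ^ 2 * (10 ^ 4 * ((θ.d₆ : ℝ) + 1) * (10 * ((θ.ℓ₆ + 1 : ℕ) : ℝ) ^ 7)) * (((θ.d₆ : ℝ) + 1) * Fintype.card (TrIdx N) * BT) *
      ((((θ.ℓ₆ + 1 : ℕ) : ℝ) ^ 3) * rowConst261 (geo9Y (d := θ.d₆) (ℓ := θ.ℓ₆) (hd := θ.hd') (hL := θ.hL') (b₀ := θ.b₀) (b₁ := θ.b₁) (Mstar := Mstar)) ρR) ≤ tHJ)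
    (hH1T : ∀ x : MemberY θ.d₆ θ.ℓ₆ θ.hd' θ.hL' θ.b₀ θ.b₁ Mstar, MT ≤ (geo9Y x).M → ∀ α₀ : ℝ, 0 < α₀ → (geo9Y x).M * α₀ ≤ aT →
      ∀ U : (bg9Y (Matrix (Fin N) (Fin N) ℂ) (specialUnitaryUnits (Fin N)) x).Cfg,
        (bg9YP (Matrix (Fin N) (Fin N) ℂ) (specialUnitaryUnits (Fin N)) x).Reg335 c35 α₀ U →
        (bg9YP (Matrix (Fin N) (Fin N) ℂ) (specialUnitaryUnits (Fin N)) x).Reg336 c35 α₀ U →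
          IsTransposePair (HcoK x.toKIdx (trBasis N) (bg9Y (Matrix (Fin N) (Fin N) ℂ) (specialUnitaryUnits (Fin N)) x) (fun U => U)
              (H1Y x.toKIdx (parSymY x.toKIdx) (parBY x.toKIdx) (GpPhysY x.toKIdx (parSymY x.toKIdx)) (resYOfC2 N θ Mstar 𝔠 x).Δ2) U) (𝔗 x U) ∧
            HasMajorantHom (g := toB6 (geo9Y x) 1 (Hg x)) (fun p : XBK (TrIdx N) x.toKIdx => bI x p.1) (fun p : XHK (TrIdx N) x.toKIdx => p.1) (𝔗 x U)
              (fun c y' => BT * WT x c * Real.exp (-(δT * (geo9Y x).dist c y')))) :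
    ∃ M₄ δ a₀ : ℝ, 0 < M₄ ∧ 0 < δ ∧ 0 < a₀ ∧ ∃ b₁ : ℝ, ∀ b₀ : ℝ, b₁ < b₀ → ∃ C : ℝ, 0 ≤ C ∧ ∀ η : ℝ, 0 < η → η ≤ 1 →
      ∀ (x : MemberY θ.d₆ θ.ℓ₆ θ.hd' θ.hL' θ.b₀ θ.b₁ Mstar) [DecidableEq (IBondY x.toKIdx)], M₄ ≤ (geo9Y x).M →
      ∀ α₀ : ℝ, 0 < α₀ → (geo9Y x).M * α₀ ≤ a₀ →
      ∀ (U : CfgY (Matrix (Fin N) (Fin N) ℂ) x.toKIdx),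
        (bg9YP (Matrix (Fin N) (Fin N) ℂ) (specialUnitaryUnits (Fin N)) x).Reg335 c35 α₀ U →
        (bg9YP (Matrix (Fin N) (Fin N) ℂ) (specialUnitaryUnits (Fin N)) x).Reg336 c35 α₀ U →
        (∀ c' : CBondStY x, ¬ GoodY x c'.1.1 → ∀ i : ℕ, i < θ.ℓ₆ →
          ‖((avYOfRecord x U ⟨ofZ x (labK x c'.1.1 + (i : ℤ) • unitVec c'.1.2), c'.1.2⟩ : (Matrix (Fin N) (Fin N) ℂ)ˣ) :
              Matrix (Fin N) (Fin N) ℂ) - 1‖ ≤ δV) →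
        (∀ A A' : FBondY x.toKIdx → Matrix (Fin N) (Fin N) ℂ, (𝔠 x).form U (star A) (star A') = star ((𝔠 x).form U A A')) →
        (∀ B B' : IBondY x.toKIdx → Matrix (Fin N) (Fin N) ℂ, (𝔡₂ x).form U (star B) (star B') = star ((𝔡₂ x).form U B B')) →
      ∀ {σ : Type} [Fintype σ] [DecidableEq σ] [Nonempty σ] (ι : σ → IBondY x.toKIdx), Function.Injective ι → (∀ s, lamTstY x (ι s)) →
        (𝔢₀ x).D2J U = d2JOfY (trDualMatY N) x.toKIdx (parSymY x.toKIdx) (parBY x.toKIdx) (GpPhysY x.toKIdx (parSymY x.toKIdx)) (resYOfC2 N θ Mstar 𝔠 x).Δ2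
          (𝔡₂ x).form U →
        (∀ (u v : IBondY x.toKIdx) (E a : Matrix (Fin N) (Fin N) ℂ), r₂ < unitDistY x u v → (𝔡₂ x).form U (Pi.single v E) (Pi.single u a) = 0) →
        (∀ (u v : IBondY x.toKIdx) (E a : Matrix (Fin N) (Fin N) ℂ), ∑ z, ‖(𝔡₂ x).form U (Pi.single v E) (Pi.single u a) z‖ ≤ C₂ * ‖E‖ * ‖a‖) →
        (∀ B : IBondY x.toKIdx → Matrix (Fin N) (Fin N) ℂ, (∀ q, ¬ inΛstY x q → B q = 0) → (∀ q, IsAxialY x q → B q = 0) →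
          (∀ c' : CBondStY x, Q1Y x (avYOfRecord x) U c'.1 B = 0) →
          γ₀ * trIP (fun _ => (1 : ℝ)) B B ≤
            trIP (fun _ => (1 : ℝ)) B (deltaKPstY x (lettersYOfRecordV4P N θ Mstar (resYOfC2 N θ Mstar 𝔠) x) (sectEStYOfRecordV7 N θ Mstar 𝔢₀ x) U B)) →
      ∃ (Λ : Finset (B1Eq324BenfattoLemma.Site (θ.d₆ + 1 + (θ.d₆ + 1) + 1))) (e' : σ × TrIdx N ≃ ↥Λ),
        ((gaussianFieldOfKernel fun u w => if h : u ∈ Λ ∧ w ∈ Λ then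
            ((Matrix.reindex e' e'
              (Matrix.of fun p q : σ × TrIdx N =>
                  trReForm (trBasis N p.2) (((CsDeltaCPstY x (lettersYOfRecordV4P N θ Mstar (resYOfC2 N θ Mstar 𝔠) x)
            (sectEStYOfRecordV7 N θ Mstar 𝔢₀ x) U).restrictScalars ℝ)
                    (Pi.single (ι q.1) (trBasis N q.2)) (ι p.1))))⁻¹ :
                Matrix ↥Λ ↥Λ ℝ) ⟨u, h.1⟩ ⟨w, h.2⟩ else 0).map
            (fun (z : B1Eq324BenfattoLemma.Site (θ.d₆ + 1 + (θ.d₆ + 1) + 1) → ℝ) (q : σ × TrIdx N) => z ((e' q : ↥Λ) : B1Eq324BenfattoLemma.Site (θ.d₆ + 1 + (θ.d₆ + 1) + 1))) =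
          gaussianFieldOfKernel fun p q =>
            ((Matrix.of fun p q : σ × TrIdx N =>
                trReForm (trBasis N p.2) (((CsDeltaCPstY x (lettersYOfRecordV4P N θ Mstar (resYOfC2 N θ Mstar 𝔠) x)
            (sectEStYOfRecordV7 N θ Mstar 𝔢₀ x) U).restrictScalars ℝ)
                  (Pi.single (ι q.1) (trBasis N q.2)) (ι p.1)))⁻¹ :
              Matrix (σ × TrIdx N) (σ × TrIdx N) ℝ) p q) ∧
        (∀ p : ℝ, 0 ≤ p →
          ((fun (z : B1Eq324BenfattoLemma.Site (θ.d₆ + 1 + (θ.d₆ + 1) + 1) → ℝ) (q : σ × TrIdx N) => z ((e' q : ↥Λ) : B1Eq324BenfattoLemma.Site (θ.d₆ + 1 + (θ.d₆ + 1) + 1))) ⁻¹'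
              {ω : σ × TrIdx N → ℝ | ∀ q, |ω q| ≤ p}) =ᵐ[gaussianFieldOfKernel fun u w => if h : u ∈ Λ ∧ w ∈ Λ then
                ((Matrix.reindex e' e'
                  (Matrix.of fun p q : σ × TrIdx N =>
                      trReForm (trBasis N p.2) (((CsDeltaCPstY x (lettersYOfRecordV4P N θ Mstar (resYOfC2 N θ Mstar 𝔠) x)
            (sectEStYOfRecordV7 N θ Mstar 𝔢₀ x) U).restrictScalars ℝ)
                        (Pi.single (ι q.1) (trBasis N q.2)) (ι p.1))))⁻¹ :
                    Matrix ↥Λ ↥Λ ℝ) ⟨u, h.1⟩ ⟨w, h.2⟩ else 0]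
            smallFieldSet Λ p) ∧
        ∀ (s : ℕ) (I J : Finset (B1Eq324BenfattoLemma.Site (θ.d₆ + 1 + (θ.d₆ + 1) + 1))) (𝔞 : Coef (θ.d₆ + 1 + (θ.d₆ + 1) + 1)),
          I.Nonempty → J ⊆ I → J ⊆ Λ → coefSup s D 𝔞 J ≤ c * η ^ σ' →
          0 < ∫ z, cutoffBoltzmann (hamiltonian s D ϰ 𝔞 J) I (B10.pFun b₀ p₀ η) z ∂(gaussianFieldOfKernel fun u w => if h : u ∈ Λ ∧ w ∈ Λ then
              ((Matrix.reindex e' e'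
                (Matrix.of fun p q : σ × TrIdx N =>
                    trReForm (trBasis N p.2) (((CsDeltaCPstY x (lettersYOfRecordV4P N θ Mstar (resYOfC2 N θ Mstar 𝔠) x)
            (sectEStYOfRecordV7 N θ Mstar 𝔢₀ x) U).restrictScalars ℝ)
                      (Pi.single (ι q.1) (trBasis N q.2)) (ι p.1))))⁻¹ :
                  Matrix ↥Λ ↥Λ ℝ) ⟨u, h.1⟩ ⟨w, h.2⟩ else 0) ∧
            |Real.log (∫ z, cutoffBoltzmann (hamiltonian s D ϰ 𝔞 J) I (B10.pFun b₀ p₀ η) z ∂(gaussianFieldOfKernel fun u w =>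
                if h : u ∈ Λ ∧ w ∈ Λ then
                  ((Matrix.reindex e' e'
                    (Matrix.of fun p q : σ × TrIdx N =>
                        trReForm (trBasis N p.2) (((CsDeltaCPstY x (lettersYOfRecordV4P N θ Mstar (resYOfC2 N θ Mstar 𝔠) x)
            (sectEStYOfRecordV7 N θ Mstar 𝔢₀ x) U).restrictScalars ℝ)
                          (Pi.single (ι q.1) (trBasis N q.2)) (ι p.1))))⁻¹ :
                      Matrix ↥Λ ↥Λ ℝ) ⟨u, h.1⟩ ⟨w, h.2⟩ else 0)) -
              cumulantSum (gaussianFieldOfKernel fun u w => if h : u ∈ Λ ∧ w ∈ Λ then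
                  ((Matrix.reindex e' e'
                    (Matrix.of fun p q : σ × TrIdx N =>
                        trReForm (trBasis N p.2) (((CsDeltaCPstY x (lettersYOfRecordV4P N θ Mstar (resYOfC2 N θ Mstar 𝔠) x)
            (sectEStYOfRecordV7 N θ Mstar 𝔢₀ x) U).restrictScalars ℝ)
                          (Pi.single (ι q.1) (trBasis N q.2)) (ι p.1))))⁻¹ :
                      Matrix ↥Λ ↥Λ ℝ) ⟨u, h.1⟩ ⟨w, h.2⟩ else 0)
                (hamiltonian s D ϰ 𝔞 J) t| ≤ C * η ^ κ' * I.card := by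
  -- the (H\*J) road: the 𝒥-row input (b†) BY NAME from the weighted transpose schema `hH1T`, `hreg` DISCHARGED at print's class (n06-w8 F12)
  have hcJ : (0 : ℝ) ≤ 10 * ((θ.ℓ₆ + 1 : ℕ) : ℝ) ^ 7 := by positivity
  obtain ⟨MH, hMH⟩ := etaDY_mul_norm_trAdjY_H1Y_JY_le_of_transpose_schemas_wR (N := N) q hq Hg
    (regYP335 (Matrix (Fin N) (Fin N) ℂ) (specialUnitaryUnits (Fin N))) (regYP336 (Matrix (Fin N) (Fin N) ℂ) (specialUnitaryUnits (Fin N))) c35 (resYOfC2 N θ Mstar 𝔠)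
    bI hbI0 𝔗 WT hWT hWη (10 * ((θ.ℓ₆ + 1 : ℕ) : ℝ) ^ 7) BT δT ρR tHJ MT aT hcJ hBT hρR hMT ha1 hδT htHJ hH1T
    (fun x _ α₀ hα _ U _ hU' μ s => regularAt_pinScale_of_regYP336 x hc10 hα.le hU' (bI x) (hβ1 x) μ ⟨s, 0⟩)
  have htHJ0 : 0 ≤ tHJ := le_trans (by
    have := rowConst261_nonneg (geo9Y (d := θ.d₆) (ℓ := θ.ℓ₆) (hd := θ.hd') (hL := θ.hL') (b₀ := θ.b₀) (b₁ := θ.b₁) (Mstar := Mstar)) ρR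
    positivity) htHJ
  have hj₁ : 0 ≤ tHJ * aT * w₁ := mul_nonneg (mul_nonneg htHJ0 haT.le) hw₁
  obtain ⟨M₄, δ, a₀, hM₄, hδ, ha₀, b₁, hb₁⟩ := eq324_CsDeltaCPstY_lettersYOfRecordV4P_sectEStYOfRecordV7_trBasis_of_stmt3132Printed_P_of_adjCurrentP_of_pivotLines_ofC2_onΛst_on_unit N θ hD Mstar 𝔠 𝔡₂ 𝔢₀ 𝔢st 𝔴 𝔈 h26
    (r₂ := r₂) (j₁ := tHJ * aT * w₁) hγ₀ hδV hj₁ hC₂ hsmall t D hϰ hp₀ hσ hc hκ hκσ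
  refine ⟨max M₄ (max MH MT), δ, min a₀ aT, lt_max_of_lt_left hM₄, hδ, lt_min ha₀ haT, b₁, fun b₀ hb₀ => ?_⟩
  obtain ⟨C, hC, hE⟩ := hb₁ b₀ hb₀
  refine ⟨C, hC, ?_⟩
  intro η hη hηle x _ hMx α₀ hα₀ hMa U h335 h336 hV hCr hDr σ _ _ _ ι hι hιT hpin hDloc hDsz hco
  have hM₄x : M₄ ≤ (geo9Y x).M := (le_max_left _ _).trans hMx
  have hMHx : MH ≤ (geo9Y x).M := ((le_max_left _ _).trans (le_max_right M₄ _)).trans hMx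
  have hMTx : MT ≤ (geo9Y x).M := ((le_max_right _ _).trans (le_max_right M₄ _)).trans hMx
  have ha₀x : (geo9Y x).M * α₀ ≤ a₀ := hMa.trans (min_le_left _ _)
  have haTx : (geo9Y x).M * α₀ ≤ aT := hMa.trans (min_le_right _ _)
  exact hE η hη hηle x hM₄x α₀ hα₀ ha₀x U h335 h336 hV hCr hDr ι hι hιT hpin (fun _ => True)
    (fun z _ => hMH x hMHx hMTx α₀ hα₀ haTx U h335 h336 z) (fun _ _ _ _ _ _ _ _ => trivial) hDloc hDsz hco


/-- ★★★★ **THE STAR DOOR OF RECORD MODULO NODE N06's SOCKET OF RECORD, over `𝔯 := resYOfC2 𝔠`, THE 𝒥-ROW INPUT BY NAME FROM NODE N06's (H\*J) ROAD** —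
§2's family form at `h26 := h06.s3132`, `c35 := c35Y` (`h06 : B9LeafX (Y9OfRecordP N θ M⋆ (opsYNuStOfRecordV4PE N θ M⋆ (resYOfC2 N θ M⋆ 𝔠) 𝔢st 𝔴 𝔈))`).  What stands
between this door and N08's row `h324c`: node N06's certificate AND its `H₁` letters (`hH1T`, node N06's currency), [5]'s letters, G-B9-09, the pivot-line row and the
IDENT.
[cite: Balaban1985BackgroundPropagators, p.422 (the sentence between (3.136) and (3.137)), (3.129) p.421, (3.132)–(3.134) p.422, Thm 3.12 p.423, (3.35)–(3.36) p.396,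
(3.155)–(3.158) pp.427–428, Thms 3.1–3.15 pp.397–432; Balaban1984PropagatorsII, (2.51) p.232, Lemma 2.1 (2.60)–(2.61) pp.233–234, (2.149) p.249, (2.3) p.224, Lemma 2.4
p.245; Balaban1985Averaging, (125)–(126) p.36, (136) p.39; Balaban1985UV3, (24) p.262; Balaban1982Higgs1, (3.24) p.616; BenfattoEtAl1978, Lemma (4.5)–(4.7) p.152 (class
form; bent window, presentation and coordinates ours)] -/
theorem eq324_CsDeltaCPstY_lettersYOfRecordV4P_sectEStYOfRecordV7_trBasis_of_b9LeafX_of_H1Schemas_of_pivotLines_ofC2_onΛst_on_unit (N : ℕ) [NeZero N]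
    (θ : Stage3Params) (hD : 2 ≤ θ.d₆ + 1) (Mstar : ℕ) (𝔠 : C2Y N θ Mstar) (𝔡₂ : Dt2Y N θ Mstar)
    (𝔢₀ : SectEY N θ Mstar) (𝔢st : SectEStY N θ Mstar) (𝔴 : RWEY N θ Mstar) (𝔈 : ExpsY N θ Mstar) 
    (h06 : B9LeafX (Y9OfRecordP N θ Mstar (opsYNuStOfRecordV4PE N θ Mstar (resYOfC2 N θ Mstar 𝔠) 𝔢st 𝔴 𝔈)))
    {γ₀ δV C₂ r₂ : ℝ} (hγ₀ : 0 < γ₀) (hδV : 0 ≤ δV) (hC₂ : 0 ≤ C₂)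
    (hsmall : (θ.ℓ₆ : ℝ) * (2 * δV) < 1)
    (t D : ℕ) {ϰ : ℝ} (hϰ : 0 < ϰ) {p₀ σ' c κ' : ℝ} (hp₀ : 2 / 3 < p₀) (hσ : 0 < σ') (hc : 0 ≤ c) (hκ : 0 < κ') (hκσ : κ' < σ' * (t + 1))
    [∀ x : MemberY θ.d₆ θ.ℓ₆ θ.hd' θ.hL' θ.b₀ θ.b₁ Mstar, Fintype (geo9Y x).Site]
    (q : PinPrims) (hq : q.OK) (Hg : MemberY θ.d₆ θ.ℓ₆ θ.hd' θ.hL' θ.b₀ θ.b₁ Mstar → Prop)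
    (bI : ∀ x : MemberY θ.d₆ θ.ℓ₆ θ.hd' θ.hL' θ.b₀ θ.b₁ Mstar, FBondY x.toKIdx → IBondY x.toKIdx)
    (hbI0 : ∀ (x : MemberY θ.d₆ θ.ℓ₆ θ.hd' θ.hL' θ.b₀ θ.b₁ Mstar) (f : FBondY x.toKIdx), bI x f = bI x ⟨f.src, 0⟩)
    (hβ1 : ∀ (x : MemberY θ.d₆ θ.ℓ₆ θ.hd' θ.hL' θ.b₀ θ.b₁ Mstar) (f : FBondY x.toKIdx), (geomT x.D).dist (β x.hN x.D x.hk (bI x f)) (blkV1 x.hN x.D f) ≤ 1)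
    (𝔗 : ∀ x : MemberY θ.d₆ θ.ℓ₆ θ.hd' θ.hL' θ.b₀ θ.b₁ Mstar, (bg9Y (Matrix (Fin N) (Fin N) ℂ) (specialUnitaryUnits (Fin N)) x).Cfg →
      (XBK (TrIdx N) x.toKIdx → ℝ) →ₗ[ℝ] (XHK (TrIdx N) x.toKIdx → ℝ))
    (WT : ∀ x : MemberY θ.d₆ θ.ℓ₆ θ.hd' θ.hL' θ.b₀ θ.b₁ Mstar, IBondY x.toKIdx → ℝ) (hWT : ∀ x c, 0 ≤ WT x c)
    {w₁ : ℝ} (hw₁ : 0 ≤ w₁) (hWη : ∀ (x : MemberY θ.d₆ θ.ℓ₆ θ.hd' θ.hL' θ.b₀ θ.b₁ Mstar) (c : IBondY x.toKIdx), etaDY x * (WT x c * ((geo9Y x).len c ^ 3)⁻¹) ≤ w₁)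
    (BT δT ρR tHJ MT aT : ℝ) (hBT : 0 ≤ BT) (hρR : 0 < ρR) (hMT : 0 < MT) (haT : 0 < aT) (ha1 : 10 * ((θ.ℓ₆ + 1 : ℕ) : ℝ) ^ 7 * aT ≤ 1)
    (hδT : q.αF * ((1 - 2 * q.α) * q.δ₀) + ρR ≤ δT)
    (htHJ : N * basisBound39 (trBasis N) ^ 2 * (10 ^ 4 * ((θ.d₆ : ℝ) + 1) * (10 * ((θ.ℓ₆ + 1 : ℕ) : ℝ) ^ 7)) * (((θ.d₆ : ℝ) + 1) * Fintype.card (TrIdx N) * BT) *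
      ((((θ.ℓ₆ + 1 : ℕ) : ℝ) ^ 3) * rowConst261 (geo9Y (d := θ.d₆) (ℓ := θ.ℓ₆) (hd := θ.hd') (hL := θ.hL') (b₀ := θ.b₀) (b₁ := θ.b₁) (Mstar := Mstar)) ρR) ≤ tHJ)
    (hH1T : ∀ x : MemberY θ.d₆ θ.ℓ₆ θ.hd' θ.hL' θ.b₀ θ.b₁ Mstar, MT ≤ (geo9Y x).M → ∀ α₀ : ℝ, 0 < α₀ → (geo9Y x).M * α₀ ≤ aT →
      ∀ U : (bg9Y (Matrix (Fin N) (Fin N) ℂ) (specialUnitaryUnits (Fin N)) x).Cfg,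
        (bg9YP (Matrix (Fin N) (Fin N) ℂ) (specialUnitaryUnits (Fin N)) x).Reg335 B9PinGeometryKLevelV1.c35Y α₀ U →
        (bg9YP (Matrix (Fin N) (Fin N) ℂ) (specialUnitaryUnits (Fin N)) x).Reg336 B9PinGeometryKLevelV1.c35Y α₀ U →
          IsTransposePair (HcoK x.toKIdx (trBasis N) (bg9Y (Matrix (Fin N) (Fin N) ℂ) (specialUnitaryUnits (Fin N)) x) (fun U => U)
              (H1Y x.toKIdx (parSymY x.toKIdx) (parBY x.toKIdx) (GpPhysY x.toKIdx (parSymY x.toKIdx)) (resYOfC2 N θ Mstar 𝔠 x).Δ2) U) (𝔗 x U) ∧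
            HasMajorantHom (g := toB6 (geo9Y x) 1 (Hg x)) (fun p : XBK (TrIdx N) x.toKIdx => bI x p.1) (fun p : XHK (TrIdx N) x.toKIdx => p.1) (𝔗 x U)
              (fun c y' => BT * WT x c * Real.exp (-(δT * (geo9Y x).dist c y')))) :
    ∃ M₄ δ a₀ : ℝ, 0 < M₄ ∧ 0 < δ ∧ 0 < a₀ ∧ ∃ b₁ : ℝ, ∀ b₀ : ℝ, b₁ < b₀ → ∃ C : ℝ, 0 ≤ C ∧ ∀ η : ℝ, 0 < η → η ≤ 1 →
      ∀ (x : MemberY θ.d₆ θ.ℓ₆ θ.hd' θ.hL' θ.b₀ θ.b₁ Mstar) [DecidableEq (IBondY x.toKIdx)], M₄ ≤ (geo9Y x).M →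
      ∀ α₀ : ℝ, 0 < α₀ → (geo9Y x).M * α₀ ≤ a₀ →
      ∀ (U : CfgY (Matrix (Fin N) (Fin N) ℂ) x.toKIdx),
        (bg9YP (Matrix (Fin N) (Fin N) ℂ) (specialUnitaryUnits (Fin N)) x).Reg335 B9PinGeometryKLevelV1.c35Y α₀ U →
        (bg9YP (Matrix (Fin N) (Fin N) ℂ) (specialUnitaryUnits (Fin N)) x).Reg336 B9PinGeometryKLevelV1.c35Y α₀ U →
        (∀ c' : CBondStY x, ¬ GoodY x c'.1.1 → ∀ i : ℕ, i < θ.ℓ₆ →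
          ‖((avYOfRecord x U ⟨ofZ x (labK x c'.1.1 + (i : ℤ) • unitVec c'.1.2), c'.1.2⟩ : (Matrix (Fin N) (Fin N) ℂ)ˣ) :
              Matrix (Fin N) (Fin N) ℂ) - 1‖ ≤ δV) →
        (∀ A A' : FBondY x.toKIdx → Matrix (Fin N) (Fin N) ℂ, (𝔠 x).form U (star A) (star A') = star ((𝔠 x).form U A A')) →
        (∀ B B' : IBondY x.toKIdx → Matrix (Fin N) (Fin N) ℂ, (𝔡₂ x).form U (star B) (star B') = star ((𝔡₂ x).form U B B')) →
      ∀ {σ : Type} [Fintype σ] [DecidableEq σ] [Nonempty σ] (ι : σ → IBondY x.toKIdx), Function.Injective ι → (∀ s, lamTstY x (ι s)) →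
        (𝔢₀ x).D2J U = d2JOfY (trDualMatY N) x.toKIdx (parSymY x.toKIdx) (parBY x.toKIdx) (GpPhysY x.toKIdx (parSymY x.toKIdx)) (resYOfC2 N θ Mstar 𝔠 x).Δ2
          (𝔡₂ x).form U →
        (∀ (u v : IBondY x.toKIdx) (E a : Matrix (Fin N) (Fin N) ℂ), r₂ < unitDistY x u v → (𝔡₂ x).form U (Pi.single v E) (Pi.single u a) = 0) →
        (∀ (u v : IBondY x.toKIdx) (E a : Matrix (Fin N) (Fin N) ℂ), ∑ z, ‖(𝔡₂ x).form U (Pi.single v E) (Pi.single u a) z‖ ≤ C₂ * ‖E‖ * ‖a‖) →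
        (∀ B : IBondY x.toKIdx → Matrix (Fin N) (Fin N) ℂ, (∀ q, ¬ inΛstY x q → B q = 0) → (∀ q, IsAxialY x q → B q = 0) →
          (∀ c' : CBondStY x, Q1Y x (avYOfRecord x) U c'.1 B = 0) →
          γ₀ * trIP (fun _ => (1 : ℝ)) B B ≤
            trIP (fun _ => (1 : ℝ)) B (deltaKPstY x (lettersYOfRecordV4P N θ Mstar (resYOfC2 N θ Mstar 𝔠) x) (sectEStYOfRecordV7 N θ Mstar 𝔢₀ x) U B)) →
      ∃ (Λ : Finset (B1Eq324BenfattoLemma.Site (θ.d₆ + 1 + (θ.d₆ + 1) + 1))) (e' : σ × TrIdx N ≃ ↥Λ),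
        ((gaussianFieldOfKernel fun u w => if h : u ∈ Λ ∧ w ∈ Λ then
            ((Matrix.reindex e' e'
              (Matrix.of fun p q : σ × TrIdx N =>
                  trReForm (trBasis N p.2) (((CsDeltaCPstY x (lettersYOfRecordV4P N θ Mstar (resYOfC2 N θ Mstar 𝔠) x)
            (sectEStYOfRecordV7 N θ Mstar 𝔢₀ x) U).restrictScalars ℝ)
                    (Pi.single (ι q.1) (trBasis N q.2)) (ι p.1))))⁻¹ :
                Matrix ↥Λ ↥Λ ℝ) ⟨u, h.1⟩ ⟨w, h.2⟩ else 0).map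
            (fun (z : B1Eq324BenfattoLemma.Site (θ.d₆ + 1 + (θ.d₆ + 1) + 1) → ℝ) (q : σ × TrIdx N) => z ((e' q : ↥Λ) : B1Eq324BenfattoLemma.Site (θ.d₆ + 1 + (θ.d₆ + 1) + 1))) =
          gaussianFieldOfKernel fun p q =>
            ((Matrix.of fun p q : σ × TrIdx N =>
                trReForm (trBasis N p.2) (((CsDeltaCPstY x (lettersYOfRecordV4P N θ Mstar (resYOfC2 N θ Mstar 𝔠) x)
            (sectEStYOfRecordV7 N θ Mstar 𝔢₀ x) U).restrictScalars ℝ)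
                  (Pi.single (ι q.1) (trBasis N q.2)) (ι p.1)))⁻¹ :
              Matrix (σ × TrIdx N) (σ × TrIdx N) ℝ) p q) ∧
        (∀ p : ℝ, 0 ≤ p →
          ((fun (z : B1Eq324BenfattoLemma.Site (θ.d₆ + 1 + (θ.d₆ + 1) + 1) → ℝ) (q : σ × TrIdx N) => z ((e' q : ↥Λ) : B1Eq324BenfattoLemma.Site (θ.d₆ + 1 + (θ.d₆ + 1) + 1))) ⁻¹'
              {ω : σ × TrIdx N → ℝ | ∀ q, |ω q| ≤ p}) =ᵐ[gaussianFieldOfKernel fun u w => if h : u ∈ Λ ∧ w ∈ Λ then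
                ((Matrix.reindex e' e'
                  (Matrix.of fun p q : σ × TrIdx N =>
                      trReForm (trBasis N p.2) (((CsDeltaCPstY x (lettersYOfRecordV4P N θ Mstar (resYOfC2 N θ Mstar 𝔠) x)
            (sectEStYOfRecordV7 N θ Mstar 𝔢₀ x) U).restrictScalars ℝ)
                        (Pi.single (ι q.1) (trBasis N q.2)) (ι p.1))))⁻¹ :
                    Matrix ↥Λ ↥Λ ℝ) ⟨u, h.1⟩ ⟨w, h.2⟩ else 0]
            smallFieldSet Λ p) ∧
        ∀ (s : ℕ) (I J : Finset (B1Eq324BenfattoLemma.Site (θ.d₆ + 1 + (θ.d₆ + 1) + 1))) (𝔞 : Coef (θ.d₆ + 1 + (θ.d₆ + 1) + 1)),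
          I.Nonempty → J ⊆ I → J ⊆ Λ → coefSup s D 𝔞 J ≤ c * η ^ σ' →
          0 < ∫ z, cutoffBoltzmann (hamiltonian s D ϰ 𝔞 J) I (B10.pFun b₀ p₀ η) z ∂(gaussianFieldOfKernel fun u w => if h : u ∈ Λ ∧ w ∈ Λ then
              ((Matrix.reindex e' e'
                (Matrix.of fun p q : σ × TrIdx N =>
                    trReForm (trBasis N p.2) (((CsDeltaCPstY x (lettersYOfRecordV4P N θ Mstar (resYOfC2 N θ Mstar 𝔠) x)
            (sectEStYOfRecordV7 N θ Mstar 𝔢₀ x) U).restrictScalars ℝ)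
                      (Pi.single (ι q.1) (trBasis N q.2)) (ι p.1))))⁻¹ :
                  Matrix ↥Λ ↥Λ ℝ) ⟨u, h.1⟩ ⟨w, h.2⟩ else 0) ∧
            |Real.log (∫ z, cutoffBoltzmann (hamiltonian s D ϰ 𝔞 J) I (B10.pFun b₀ p₀ η) z ∂(gaussianFieldOfKernel fun u w =>
                if h : u ∈ Λ ∧ w ∈ Λ then
                  ((Matrix.reindex e' e'
                    (Matrix.of fun p q : σ × TrIdx N =>
                        trReForm (trBasis N p.2) (((CsDeltaCPstY x (lettersYOfRecordV4P N θ Mstar (resYOfC2 N θ Mstar 𝔠) x)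
            (sectEStYOfRecordV7 N θ Mstar 𝔢₀ x) U).restrictScalars ℝ)
                          (Pi.single (ι q.1) (trBasis N q.2)) (ι p.1))))⁻¹ :
                      Matrix ↥Λ ↥Λ ℝ) ⟨u, h.1⟩ ⟨w, h.2⟩ else 0)) -
              cumulantSum (gaussianFieldOfKernel fun u w => if h : u ∈ Λ ∧ w ∈ Λ then
                  ((Matrix.reindex e' e'
                    (Matrix.of fun p q : σ × TrIdx N =>
                        trReForm (trBasis N p.2) (((CsDeltaCPstY x (lettersYOfRecordV4P N θ Mstar (resYOfC2 N θ Mstar 𝔠) x)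
            (sectEStYOfRecordV7 N θ Mstar 𝔢₀ x) U).restrictScalars ℝ)
                          (Pi.single (ι q.1) (trBasis N q.2)) (ι p.1))))⁻¹ :
                      Matrix ↥Λ ↥Λ ℝ) ⟨u, h.1⟩ ⟨w, h.2⟩ else 0)
                (hamiltonian s D ϰ 𝔞 J) t| ≤ C * η ^ κ' * I.card :=
  eq324_CsDeltaCPstY_lettersYOfRecordV4P_sectEStYOfRecordV7_trBasis_of_stmt3132Printed_P_of_H1Schemas_of_pivotLines_ofC2_onΛst_on_unit N θ hD Mstar 𝔠 𝔡₂ 𝔢₀ 𝔢st 𝔴 𝔈 h06.s3132 hγ₀ hδV hC₂ hsmall t D hϰ hp₀ hσ hc hκ hκσ (by show B9PinGeometryKLevelV1.c35Y ≤ 10; norm_num [B9PinGeometryKLevelV1.c35Y])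
    q hq Hg bI hbI0 hβ1 𝔗 WT hWT hw₁ hWη BT δT ρR tHJ MT aT hBT hρR hMT haT ha1 hδT htHJ hH1T

end DoorsC2

end Literature.MathematicalPhysics.QuantumFieldTheory.Balaban1983to89.B1Eq324BenfattoClassSectEMemberPrecisionDoorRecordV4PAdjCurrentSchemas

end
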